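import Literature.NumberTheory.Automorphic.UnitaryGroupBorelClassLatticeSumUnfoldingTwo
import Literature.NumberTheory.Automorphic.UnitaryGroupTruncatedKernelClassHighCuspTwo
import Literature.MeasureTheory.Group.InvariantQuotientChainRule
import HarnessLib

/-!
# `∫_{n ∈ Ω} k^T_𝔬(n g₀) dn = 0` HIGH IN THE CUSP for a REGULAR class of `U(J₂)` — the `N`-level vanishing of the
# lattice-sum remainder, and the one-coset collapse of its pseudo-Eisenstein series
(Arthur, *A trace formula for reductive groups I*, Duke Math. J. 45 (1978), §8: for an unramified class the parabolic
correction terms unfold over `P(F)\G(𝔸)` and the `N(F)\N(𝔸)`-integral of «`K_{P,𝔬}` minus the lattice sum» vanishes;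
Rogawski, *Automorphic Representations of Unitary Groups in Three Variables* (1990), §2.2 p. 13, §6.1 pp. 79–80
(«Let `G = U(3)`, `U(2)`, or `U(2) × U(1)`»); Gelbart, *Automorphic forms on adele groups* (1975), §9.B (9.40)–(9.45))

Topic `NumberTheory/Automorphic`; namespace `Literature.NumberTheory.Automorphic.UnitaryGroup`. THEOREMS ONLY over
accepted tree modules: no definition, no named fact, no instance, no notation, no `sorry`. H-SIDE copy of LAWS 1–5
(`H = U(Φ₂) × U(Φ₁)`, rank-one factor `U(J₂)`) of the T1 line `Cruxes/H413/Lines/F0_T1InnerFormTraceIdentity.lean`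
(cell `pub/hodgecm-mathlib`, crux H413; census `CENSUS-LAWS-Hside.F0P3a-p03g6.md` §3, the (W2-b) trilogy at `N = 2`,
FILE 3a = the `N = 2` sibling of §§1–2 of ★ `UnitaryGroupTruncatedKernelClassCuspVanishing`). With
`D_𝔬(y) := K_{B,𝔬}(y,y) − Σ_{β ∈ B(F)∩𝔬̲} f(y⁻¹βy)` and `R_T := Σ_{δ ∈ B(F)\G(F)} 1_{T<H(δ·)} D_𝔬(δ·)`:

* §1 `tsum_indicator_borelQuotient_eq_indicator_of_rational_mul_two` — the one-coset collapse for `tsum`s with values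
  in any topological additive monoid (so also for `‖·‖ₑ`): at most one coset of `B(F)\G(F)` is high in the cusp (★
  `not_lt_borelHeight_mul_of_not_mem_arithmeticBorel_two`).
* §2 the `N`-level vanishing: **`setIntegral_truncatedKernelClass_unipotent_mul_eq_zero_two`** —
  `∫_{n ∈ Ω} k^T_𝔬(n g₀) dν(n) = 0` for every `g₀` high in the cusp (`T < H(g₀)`), every fundamental domain `Ω ⊆ N(𝔸_F)`
  of `N(F)` of finite measure, for a REGULAR class (`hreg : cl β = 𝔬 → diagUnit β 0 ≠ diagUnit β 1`): on `{T < H}`,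
  `k^T_𝔬 = K_𝔬 − K_{B,𝔬} = −D_𝔬` (★ `truncatedKernelClass_eq_kernelClass_sub_kernelBorelClass_two` + the Borel-collapse
  threshold `c₀`), then ★ (W2-b)_two FILE 2b `setIntegral_kernelBorelClass_sub_borelSumClass_translate_eq_zero_two`.
  In the letters of the Iwasawa decomposition (`Ω ⊆ unipotentInBorel F E c 2` a strict measurable fundamental set of
  `N(F)`, read back in `N(𝔸_F) = adelicUnipotent` along the tautological inclusion):
  `isFundamentalDomain_preimage_inclusion_two` (a fundamental domain of FINITE measure — compared with the relatively
  compact line domain `n(𝓕⁻)` of ★ H-B1a `UnitaryGroupLineUnipotentTwo`) and the HEAD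
  **`setIntegral_truncatedKernelClass_unipotent_mul_eq_zero_two`** (`∫_{n∈Ω} k^T_𝔬(n g₀) dμ_N = 0` for ANY Haar measure
  `μ_N` of `N(𝔸_F) ≤ B(𝔸_F)` — the form ★ FILE 3b §3 consumes; the clean `N(𝔸_F)`-form is
  `setIntegral_truncatedKernelClass_unipotent_mul_eq_zero_of_isFundamentalDomain_two`).

HONEST LABEL: no printed statement is consumed; HC_CM is proved only modulo the printed citations until rung 0
closes. For the central classes `z·𝒰(F)` `∫ R_T ≠ 0` ([Rogawski1990, Prop. 7.3.1]); `hreg` is essential.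

## References

* J. Arthur, *A trace formula for reductive groups I: terms associated to classes in `G(ℚ)`*, Duke Math. J. 45
  (1978), §8 [Arthur1978TraceFormulaI].
* J. D. Rogawski, *Automorphic Representations of Unitary Groups in Three Variables*, Annals of Mathematics
  Studies 123 (1990), §2.2 (p. 13), §6.1 (pp. 79–80) [Rogawski1990].
* S. Gelbart, *Automorphic forms on adele groups*, Annals of Mathematics Studies 83 (1975), §9.B [Gelbart1975].
-/

set_option autoImplicit false

noncomputable section

open MeasureTheory Measure NumberField IsDedekindDomain Set
open scoped NNReal ENNReal MatrixGroups

namespace Literature.NumberTheory.Automorphic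

namespace UnitaryGroup

variable {F E : Type} [Field F] [NumberField F] [Field E] [NumberField E] [Algebra F E]
  {c : E ≃ₐ[F] E} {ι : Type*}

/-! ## §1 The one-coset collapse for `tsum`s (`U(J₂)`) -/

section Collapse

variable {M : Type*} [AddCommMonoid M] [TopologicalSpace M]

/-- **One-coset collapse, `tsum` form** (`U(J₂)`, `T ≥ 1`, values in any topological additive monoid):
for a left-`G(F)`-invariant `φ`, `Σ'_{q ∈ B(F)\G(F)} 1_{T<H(q̃x)} φ(q̃x) = 1_{∃ γ ∈ G(F), T < H(γx)} φ(x)` — at most one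
coset is high in the cusp (★ `not_lt_borelHeight_mul_of_not_mem_arithmeticBorel_two`); the `N = 2` twin of ★
`tsum_indicator_borelQuotient_eq_indicator_of_rational_mul`. [cite: Gelbart1975, §9.B]
[cite: Arthur1978TraceFormulaI, §8] -/
theorem tsum_indicator_borelQuotient_eq_indicator_of_rational_mul_two {φ : (quasiSplit F E c 2).Adelic → M}
    (hφ : ∀ (γ : (quasiSplit F E c 2).arithmeticSubgroup) (y : (quasiSplit F E c 2).Adelic),
      φ ((γ : (quasiSplit F E c 2).Adelic) * y) = φ y)
    {T : ℝ≥0} (hT : 1 ≤ T) (x : (quasiSplit F E c 2).Adelic) :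
    ∑' q : Quotient (QuotientGroup.rightRel (arithmeticBorel F E c 2)),
        ({y : (quasiSplit F E c 2).Adelic | T < borelHeight y}.indicator φ)
          (((q.out : (quasiSplit F E c 2).arithmeticSubgroup) : (quasiSplit F E c 2).Adelic) * x) =
      {x : (quasiSplit F E c 2).Adelic | ∃ γ : (quasiSplit F E c 2).arithmeticSubgroup,
          T < borelHeight ((γ : (quasiSplit F E c 2).Adelic) * x)}.indicator φ x := by
  classical
  set C : Set (quasiSplit F E c 2).Adelic := {y | T < borelHeight y} with hC
  set S : Set (quasiSplit F E c 2).Adelic := {x | ∃ γ : (quasiSplit F E c 2).arithmeticSubgroup,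
    T < borelHeight ((γ : (quasiSplit F E c 2).Adelic) * x)} with hS
  by_cases hx : x ∈ S
  · obtain ⟨γ₀, hγ₀⟩ := hx
    rw [Set.indicator_of_mem (show x ∈ S from ⟨γ₀, hγ₀⟩) φ]
    set q₀ : Quotient (QuotientGroup.rightRel (arithmeticBorel F E c 2)) :=
      Quotient.mk (QuotientGroup.rightRel (arithmeticBorel F E c 2)) γ₀ with hq₀
    -- every coset high in the cusp is `q₀`
    have huniq : ∀ q : Quotient (QuotientGroup.rightRel (arithmeticBorel F E c 2)),
        ((q.out : (quasiSplit F E c 2).arithmeticSubgroup) : (quasiSplit F E c 2).Adelic) * x ∈ C → q = q₀ := by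
      intro q hq
      have hmem : q.out * γ₀⁻¹ ∈ arithmeticBorel F E c 2 := by
        by_contra hnot
        refine not_lt_borelHeight_mul_of_not_mem_arithmeticBorel_two hnot hT hγ₀ ?_
        have h : ((q.out * γ₀⁻¹ : (quasiSplit F E c 2).arithmeticSubgroup) : (quasiSplit F E c 2).Adelic) *
            (((γ₀ : (quasiSplit F E c 2).arithmeticSubgroup) : (quasiSplit F E c 2).Adelic) * x) =
            ((q.out : (quasiSplit F E c 2).arithmeticSubgroup) : (quasiSplit F E c 2).Adelic) * x := by
          rw [Subgroup.coe_mul, Subgroup.coe_inv, mul_assoc, inv_mul_cancel_left]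
        rw [h]
        exact hq
      rw [← Quotient.out_eq q, hq₀]
      exact Quotient.sound (QuotientGroup.rightRel_apply.2 (by
        have h := Subgroup.inv_mem _ hmem
        rwa [_root_.mul_inv_rev, inv_inv] at h))
    rw [tsum_eq_single q₀ (fun q hq => Set.indicator_of_notMem (s := C) (fun hmem => hq (huniq q hmem)) φ)]
    -- the `q₀`-term
    have hrel : q₀.out * γ₀⁻¹ ∈ arithmeticBorel F E c 2 := by
      have h : @Setoid.r _ (QuotientGroup.rightRel (arithmeticBorel F E c 2)) q₀.out γ₀ :=
        Quotient.exact (by rw [Quotient.out_eq, hq₀])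
      rw [QuotientGroup.rightRel_apply] at h
      have h' := Subgroup.inv_mem _ h
      rwa [_root_.mul_inv_rev, inv_inv] at h'
    have hhigh : ((q₀.out : (quasiSplit F E c 2).arithmeticSubgroup) : (quasiSplit F E c 2).Adelic) * x ∈ C := by
      obtain ⟨b, hb⟩ := (q₀.out * γ₀⁻¹ : (quasiSplit F E c 2).arithmeticSubgroup).2
      have hbB : (quasiSplit F E c 2).toAdelic b ∈ borelAdelic F E c 2 := by
        rw [hb]; exact (mem_arithmeticBorel_iff _).1 hrel
      have heq : ((q₀.out : (quasiSplit F E c 2).arithmeticSubgroup) : (quasiSplit F E c 2).Adelic) * x =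
          (quasiSplit F E c 2).toAdelic b * (((γ₀ : (quasiSplit F E c 2).arithmeticSubgroup) : (quasiSplit F E c 2).Adelic) * x) := by
        rw [hb, Subgroup.coe_mul, Subgroup.coe_inv, mul_assoc, inv_mul_cancel_left]
      change T < borelHeight _
      rw [heq, borelHeight_rational_borel_mul b hbB]
      exact hγ₀
    rw [Set.indicator_of_mem hhigh φ, hφ]
  · rw [Set.indicator_of_notMem hx φ]
    have h0 : ∀ q : Quotient (QuotientGroup.rightRel (arithmeticBorel F E c 2)),
        C.indicator φ (((q.out : (quasiSplit F E c 2).arithmeticSubgroup) : (quasiSplit F E c 2).Adelic) * x) = 0 :=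
      fun q => Set.indicator_of_notMem (s := C) (fun hq => hx ⟨q.out, hq⟩) φ
    simp_rw [h0]
    exact tsum_zero

end Collapse

/-! ## §2 The `N`-level vanishing (`U(J₂)`, regular class) -/

section Unipotent

variable [MeasurableSpace (adelicUnipotent F E c 2)] [BorelSpace (adelicUnipotent F E c 2)]

/-- **`∫_{n ∈ Ω} k^T_𝔬(n g₀) dν(n) = 0` HIGH IN THE CUSP, FOR A REGULAR CLASS OF `U(J₂)`** (quadratic `E/F`,
`c² = 1 ≠ c`; class map with Rogawski's two axioms; `ν` a Haar measure of `N(𝔸_F)` with `𝓕` a fundamental domain of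
`N(F)` (the data of `K_{B,𝔬}`) and `Ω` a fundamental domain of `N(F)` of finite measure; `f ∈ C_c`; `T ≥ 1` above the
Borel-collapse threshold `c₀`; `g₀` with `T < H(g₀)`): for every `n ∈ N(𝔸_F)` the point `n g₀` is high in the cusp
(`H(n g₀) = H(g₀)`, ★ `borelHeight_unipotent_mul`), so `k^T_𝔬(n g₀) = K_𝔬 − K_{B,𝔬} = −D_𝔬(n g₀)` (★
`truncatedKernelClass_eq_kernelClass_sub_kernelBorelClass_two` + `c₀`), and `∫_Ω D_𝔬(n g₀) dn = 0` is ★ (W2-b)_two FILE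
2b `setIntegral_kernelBorelClass_sub_borelSumClass_translate_eq_zero_two`. [cite: Arthur1978TraceFormulaI, §8]
[cite: Rogawski1990, §2.2 (p. 13); §6.1 (pp. 79–80)] -/
theorem setIntegral_truncatedKernelClass_unipotent_mul_eq_zero_of_isFundamentalDomain_two (hc : c * c = 1) (hc1 : c ≠ 1)
    {cl : (quasiSplit F E c 2).arithmeticSubgroup → ι} (hcl : IsConjInvariant cl)
    (hclN : IsUnipotentInvariantOnBorel F E c 2 cl) (i : ι)
    (hreg : ∀ β : arithmeticBorel F E c 2, cl β = i →
      diagUnit ((mem_arithmeticBorel_iff _).1 β.2) 0 ≠ diagUnit ((mem_arithmeticBorel_iff _).1 β.2) 1)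
    (ν : Measure (adelicUnipotent F E c 2)) [ν.IsHaarMeasure]
    {𝓕 : Set (adelicUnipotent F E c 2)} (h𝓕 : IsFundamentalDomain (rationalUnipotent F E c 2) 𝓕 ν)
    {Ω : Set (adelicUnipotent F E c 2)} (hΩ : IsFundamentalDomain (rationalUnipotent F E c 2) Ω ν) (hΩtop : ν Ω ≠ ⊤)
    {f : (quasiSplit F E c 2).Adelic → ℂ} (hfc : Continuous f) (hf : HasCompactSupport f) {c₀ : ℝ≥0}
    (hc₀ : ∀ g : (quasiSplit F E c 2).Adelic, c₀ < borelHeight g → kernelClass cl i f g g = borelSumClass cl i f g g)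
    {T : ℝ≥0} (hT : 1 ≤ T) (hTc : c₀ ≤ T) {g₀ : (quasiSplit F E c 2).Adelic} (hg₀ : T < borelHeight g₀) :
    ∫ n in Ω, truncatedKernelClass ν 𝓕 T cl i f (((n : adelicUnipotent F E c 2) : (quasiSplit F E c 2).Adelic) * g₀) ∂ν = 0 := by
  -- pointwise collapse `k^T_𝔬(n g₀) = −D_𝔬(n g₀)`
  have hpt : ∀ n : adelicUnipotent F E c 2,
      truncatedKernelClass ν 𝓕 T cl i f (((n : adelicUnipotent F E c 2) : (quasiSplit F E c 2).Adelic) * g₀) =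
        -(kernelBorelClass ν 𝓕 cl i f (((n : adelicUnipotent F E c 2) : (quasiSplit F E c 2).Adelic) * g₀)
            (((n : adelicUnipotent F E c 2) : (quasiSplit F E c 2).Adelic) * g₀) -
          borelSumClass cl i f (((n : adelicUnipotent F E c 2) : (quasiSplit F E c 2).Adelic) * g₀)
            (((n : adelicUnipotent F E c 2) : (quasiSplit F E c 2).Adelic) * g₀)) := by
    intro n
    have hH : borelHeight (((n : adelicUnipotent F E c 2) : (quasiSplit F E c 2).Adelic) * g₀) = borelHeight g₀ :=
      borelHeight_unipotent_mul n.2 g₀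
    have hg : T < borelHeight (((n : adelicUnipotent F E c 2) : (quasiSplit F E c 2).Adelic) * g₀) := by rw [hH]; exact hg₀
    rw [truncatedKernelClass_eq_kernelClass_sub_kernelBorelClass_two hcl hclN ν h𝓕 i f hT hg, hc₀ _ (hTc.trans_lt hg)]
    ring
  simp_rw [hpt]
  rw [integral_neg, neg_eq_zero]
  exact setIntegral_kernelBorelClass_sub_borelSumClass_translate_eq_zero_two hc hc1 hclN i hreg ν h𝓕 hΩ hΩtop hfc hf g₀

variable [MeasurableSpace (quasiSplit F E c 2).Adelic] [BorelSpace (quasiSplit F E c 2).Adelic]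

/-- **A strict measurable fundamental set of `N(F)` in `unipotentInBorel F E c 2`, read back in `N(𝔸_F) = adelicUnipotent`
along the tautological inclusion `n ↦ ⟨⟨n, _⟩, _⟩` (Mathlib `(Subgroup.subgroupOfEquivOfLe _).symm`), is an (a.e.)
fundamental domain of `N(F)` of FINITE measure** for every Haar measure `ν` of `N(𝔸_F)` (its measure is that of the
relatively compact line domain `n(𝓕⁻)` of ★ H-B1a, Mathlib `IsFundamentalDomain.measure_eq`) — the `N = 2` replacement of
★ `isFundamentalDomain_preimage_unipToBorel`. [cite: Rogawski1990, §2.1 (p. 11)] [cite: Arthur1978TraceFormulaI, §1] -/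
theorem isFundamentalDomain_preimage_inclusion_two (hc : c * c = 1)
    (ν : Measure (adelicUnipotent F E c 2)) [ν.IsHaarMeasure]
    {Ω : Set (unipotentInBorel F E c 2)} (hΩm : MeasurableSet Ω)
    (hΩu : ∀ n : unipotentInBorel F E c 2,
      ∃! γ : (((quasiSplit F E c 2).arithmeticSubgroup).subgroupOf (borelAdelic F E c 2)).subgroupOf
        (unipotentInBorel F E c 2), γ • n ∈ Ω) :
    IsFundamentalDomain (rationalUnipotent F E c 2)
        ((fun n : adelicUnipotent F E c 2 =>
          (⟨⟨(n : (quasiSplit F E c 2).Adelic), adelicUnipotent_le_borelAdelic n.2⟩, n.2⟩ : unipotentInBorel F E c 2)) ⁻¹' Ω) ν ∧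
      ν ((fun n : adelicUnipotent F E c 2 =>
          (⟨⟨(n : (quasiSplit F E c 2).Adelic), adelicUnipotent_le_borelAdelic n.2⟩, n.2⟩ : unipotentInBorel F E c 2)) ⁻¹' Ω) ≠ ⊤ := by
  have hij : (((0 : Fin 2) : Fin 2) : ℕ) + 1 = (((1 : Fin 2) : Fin 2) : ℕ) := rfl
  have hN : 2 = 2 * (((0 : Fin 2) : Fin 2) : ℕ) + 2 := rfl
  set incl : adelicUnipotent F E c 2 → unipotentInBorel F E c 2 := fun n =>
    (⟨⟨(n : (quasiSplit F E c 2).Adelic), adelicUnipotent_le_borelAdelic n.2⟩, n.2⟩ : unipotentInBorel F E c 2) with hincl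
  have hinclc : Continuous incl := (continuous_subtype_val.subtype_mk _).subtype_mk _
  haveI : MeasurableConstSMul (rationalUnipotent F E c 2) (adelicUnipotent F E c 2) :=
    ⟨fun γ => (continuous_const.mul continuous_id).measurable⟩
  haveI : SMulInvariantMeasure (rationalUnipotent F E c 2) (adelicUnipotent F E c 2) ν :=
    ⟨fun γ s _hs => by
      rw [show (fun u : adelicUnipotent F E c 2 => γ • u) ⁻¹' s =
          (fun u : adelicUnipotent F E c 2 => ((γ : adelicUnipotent F E c 2)) * u) ⁻¹' s from rfl,
        measure_preimage_mul]⟩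
  haveI : Countable (rationalUnipotent F E c 2) := by
    haveI : Countable (quasiSplit F E c 2).arithmeticSubgroup := by
      haveI : Countable E := NumberField.countable' (K := E)
      haveI : Countable (Matrix (Fin 2) (Fin 2) E) := inferInstanceAs (Countable (Fin 2 → Fin 2 → E))
      haveI : Countable (GL (Fin 2) E) := Units.val_injective.countable
      haveI : Countable (quasiSplit F E c 2).Rational :=
        inferInstanceAs (Countable (rational F E c 2 ((StdForm.antidiagonal 2).over E)))
      exact (Set.countable_range _).to_subtype
    have h1 : Function.Injective fun γ : rationalUnipotent F E c 2 =>
        (⟨((γ : adelicUnipotent F E c 2) : (quasiSplit F E c 2).Adelic), γ.2⟩ :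
          (quasiSplit F E c 2).arithmeticSubgroup) := fun a a' h =>
      Subtype.ext (Subtype.ext (congrArg
        (fun z : (quasiSplit F E c 2).arithmeticSubgroup => (z : (quasiSplit F E c 2).Adelic)) h))
    exact h1.countable
  -- the strict fundamental-set property, transported along the inclusion
  have hstrict : ∀ u : adelicUnipotent F E c 2, ∃! γ : rationalUnipotent F E c 2, γ • u ∈ incl ⁻¹' Ω := by
    intro u
    obtain ⟨γ, hγ, huniq⟩ := hΩu (incl u)
    refine ⟨⟨⟨(((γ : unipotentInBorel F E c 2) : borelAdelic F E c 2) : (quasiSplit F E c 2).Adelic),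
      (γ : unipotentInBorel F E c 2).2⟩, γ.2⟩, ?_, ?_⟩
    · change incl (_ * u) ∈ Ω
      have h : incl ((⟨⟨(((γ : unipotentInBorel F E c 2) : borelAdelic F E c 2) : (quasiSplit F E c 2).Adelic),
          (γ : unipotentInBorel F E c 2).2⟩, γ.2⟩ : rationalUnipotent F E c 2) * u) =
          (γ : unipotentInBorel F E c 2) * incl u := rfl
      rw [h]
      exact hγ
    · intro γ' hγ'
      have h := huniq ⟨incl (γ' : adelicUnipotent F E c 2), γ'.2⟩ (by
        change ((⟨incl (γ' : adelicUnipotent F E c 2), γ'.2⟩ : (((quasiSplit F E c 2).arithmeticSubgroup).subgroupOf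
          (borelAdelic F E c 2)).subgroupOf (unipotentInBorel F E c 2)) : unipotentInBorel F E c 2) * incl u ∈ Ω
        exact hγ')
      apply Subtype.ext
      apply Subtype.ext
      change ((γ' : adelicUnipotent F E c 2) : (quasiSplit F E c 2).Adelic) =
        (((γ : unipotentInBorel F E c 2) : borelAdelic F E c 2) : (quasiSplit F E c 2).Adelic)
      rw [← h]
  have hpre : MeasurableSet (incl ⁻¹' Ω) := hΩm.preimage hinclc.measurable
  have hFD : IsFundamentalDomain (rationalUnipotent F E c 2) (incl ⁻¹' Ω) ν :=
    IsFundamentalDomain.mk' hpre.nullMeasurableSet hstrict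
  refine ⟨hFD, ?_⟩
  -- finite measure: compare with the relatively compact line domain `n(𝓕⁻)`
  letI : MeasurableSpace (AdeleRing (𝓞 E) E) := borel _
  haveI : BorelSpace (AdeleRing (𝓞 E) E) := ⟨rfl⟩
  have hline := isFundamentalDomain_image_traceZeroFundamentalDomain_two (F := F) (E := E) (c := c) hij hN hc ν
  obtain ⟨C, hC, hsub⟩ := exists_isCompact_image_traceZeroFundamentalDomain_subset_two (F := F) (E := E) (c := c) hij hN hc
  rw [hFD.measure_eq hline]
  exact ((measure_mono hsub).trans_lt hC.measure_lt_top).ne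

/-- **`∫_{n ∈ Ω} k^T_𝔬(n g₀) dμ_N(n) = 0` HIGH IN THE CUSP, IN THE LETTERS OF THE IWASAWA DECOMPOSITION** (`U(J₂)`; the
head ★ FILE 3b §3 consumes): `Ω ⊆ unipotentInBorel F E c 2` a strict measurable fundamental set of `N(F)`, `μ_N` ANY Haar
measure of `N(𝔸_F) ≤ B(𝔸_F)` (all Haar measures are proportional and both terms of `D_𝔬` scale alike), `ν`∕`𝓕` the data of
`K_{B,𝔬}`, the other data as in `setIntegral_truncatedKernelClass_unipotent_mul_eq_zero_of_isFundamentalDomain_two`.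
Route: the tautological `e : N(𝔸_F) ≃ₜ* unipotentInBorel` (Mathlib `Subgroup.subgroupOfEquivOfLe`, definition-free),
`ν′ := (e⁻¹)_* μ_N` is a Haar measure of `N(𝔸_F)`, so `ν′ = haarScalarFactor ν′ ν • ν` (Mathlib `isMulLeftInvariant_eq_smul`);
`e ⁻¹' Ω` is a `ν`-fundamental domain of finite mass (`isFundamentalDomain_preimage_inclusion_two`); then the
previous theorem and `integral_smul_nnreal_measure`. [cite: Arthur1978TraceFormulaI, §8] [cite: Rogawski1990, §2.2 (p. 13); §6.1 (pp. 79–80)] -/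
theorem setIntegral_truncatedKernelClass_unipotent_mul_eq_zero_two (hc : c * c = 1) (hc1 : c ≠ 1)
    {cl : (quasiSplit F E c 2).arithmeticSubgroup → ι} (hcl : IsConjInvariant cl)
    (hclN : IsUnipotentInvariantOnBorel F E c 2 cl) (i : ι)
    (hreg : ∀ β : arithmeticBorel F E c 2, cl β = i →
      diagUnit ((mem_arithmeticBorel_iff _).1 β.2) 0 ≠ diagUnit ((mem_arithmeticBorel_iff _).1 β.2) 1)
    (ν : Measure (adelicUnipotent F E c 2)) [ν.IsHaarMeasure]
    {𝓕 : Set (adelicUnipotent F E c 2)} (h𝓕 : IsFundamentalDomain (rationalUnipotent F E c 2) 𝓕 ν)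
    (μN : Measure (unipotentInBorel F E c 2)) [μN.IsHaarMeasure]
    {Ω : Set (unipotentInBorel F E c 2)} (hΩm : MeasurableSet Ω)
    (hΩu : ∀ n : unipotentInBorel F E c 2,
      ∃! γ : (((quasiSplit F E c 2).arithmeticSubgroup).subgroupOf (borelAdelic F E c 2)).subgroupOf
        (unipotentInBorel F E c 2), γ • n ∈ Ω)
    {f : (quasiSplit F E c 2).Adelic → ℂ} (hfc : Continuous f) (hf : HasCompactSupport f) {c₀ : ℝ≥0}
    (hc₀ : ∀ g : (quasiSplit F E c 2).Adelic, c₀ < borelHeight g → kernelClass cl i f g g = borelSumClass cl i f g g)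
    {T : ℝ≥0} (hT : 1 ≤ T) (hTc : c₀ ≤ T) {g₀ : (quasiSplit F E c 2).Adelic} (hg₀ : T < borelHeight g₀) :
    ∫ n in Ω, truncatedKernelClass ν 𝓕 T cl i f (((n : borelAdelic F E c 2) : (quasiSplit F E c 2).Adelic) * g₀) ∂μN = 0 := by
  -- topology on `N(𝔸_F)`
  haveI : LocallyCompactSpace (AdeleRing (𝓞 E) E) := locallyCompactSpace_adeleRing' E
  haveI := locallyCompactSpace_adelicUnipotent_two (F := F) (E := E) (c := c)
  haveI := secondCountableTopology_adeleRing E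
  haveI : SecondCountableTopology (quasiSplit F E c 2).Adelic :=
    inferInstanceAs (SecondCountableTopology (adelic F E c 2 ((StdForm.antidiagonal 2).over E)))
  haveI : SecondCountableTopology (adelicUnipotent F E c 2) := TopologicalSpace.Subtype.secondCountableTopology _
  -- the tautological `e : N(𝔸_F) ≃ₜ* unipotentInBorel`, definition-free
  set e₀ : adelicUnipotent F E c 2 ≃* unipotentInBorel F E c 2 :=
    (Subgroup.subgroupOfEquivOfLe (adelicUnipotent_le_borelAdelic (F := F) (E := E) (c := c) (N := 2))).symm with he₀
  have he₀c : Continuous e₀ :=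
    Literature.MeasureTheory.Group.continuous_subgroupOfEquivOfLe_symm _ _
      (adelicUnipotent_le_borelAdelic (F := F) (E := E) (c := c) (N := 2))
  have he₀s : Continuous e₀.symm :=
    Literature.MeasureTheory.Group.continuous_subgroupOfEquivOfLe _ _
      (adelicUnipotent_le_borelAdelic (F := F) (E := E) (c := c) (N := 2))
  set e : adelicUnipotent F E c 2 ≃ₜ* unipotentInBorel F E c 2 :=
    { e₀ with continuous_toFun := he₀c, continuous_invFun := he₀s } with he
  set em : adelicUnipotent F E c 2 ≃ᵐ unipotentInBorel F E c 2 := e.toHomeomorph.toMeasurableEquiv with hem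
  -- `ν' := e⁻¹_* μN` is a Haar measure on `N(𝔸_F)`, hence a multiple of `ν`
  set ν' : Measure (adelicUnipotent F E c 2) := Measure.map em.symm μN with hν'
  haveI : ν'.IsHaarMeasure := e.symm.isHaarMeasure_map μN
  have hk : ν' = ν'.haarScalarFactor ν • ν := isMulLeftInvariant_eq_smul ν' ν
  -- pull the integral back to `N(𝔸_F)`
  have hμN : μN = Measure.map em ν' := by rw [hν', MeasurableEquiv.map_map_symm]
  rw [hμN, setIntegral_map_equiv]
  have hpre : (em : adelicUnipotent F E c 2 → unipotentInBorel F E c 2) ⁻¹' Ω =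
      (fun n : adelicUnipotent F E c 2 =>
        (⟨⟨(n : (quasiSplit F E c 2).Adelic), adelicUnipotent_le_borelAdelic n.2⟩, n.2⟩ : unipotentInBorel F E c 2)) ⁻¹' Ω :=
    rfl
  have hcoe : ∀ n : adelicUnipotent F E c 2,
      (((em n : unipotentInBorel F E c 2) : borelAdelic F E c 2) : (quasiSplit F E c 2).Adelic) =
        (n : (quasiSplit F E c 2).Adelic) := fun n => rfl
  simp_rw [hcoe]
  rw [hpre, hk, Measure.restrict_smul, integral_smul_nnreal_measure]
  obtain ⟨hΩ', hΩ'top⟩ := isFundamentalDomain_preimage_inclusion_two (F := F) (E := E) (c := c) hc ν hΩm hΩu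
  rw [setIntegral_truncatedKernelClass_unipotent_mul_eq_zero_of_isFundamentalDomain_two hc hc1 hcl hclN i hreg ν h𝓕 hΩ'
    hΩ'top hfc hf hc₀ hT hTc hg₀, smul_zero]

end Unipotent

end UnitaryGroup

end Literature.NumberTheory.Automorphic

end
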